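import Summits.Ventures.PercRepro.ProfileGapMonoThresholdCorankTwo

/-!
# PercRepro — THE TOP THRESHOLD AT RANK `q` IS TRIVIAL, AND THE TARGETS ABOVE A DEMANDING SET (p5, gen 31;
`proofs/P5-GM1.md` §42(d), §43(c))

(a) At rank `ρ(E) ≤ q` the threshold `t = q − 1` is trivial on EVERY matroid: `(I_{q−1}) ⟺ (I_q)` (§23,
`thresholdIneq_pred_iff`) and `(I_q)` is vacuous at rank `≤ q` — `thresholdIneq_pred_of_rk_le`; in the row
vocabulary **`profileIneqMinusQ_pred_of_rk_le`** / **`profileIneq_pred_of_rk_le`**: the rows `(q − 1, q)` of `Π⁻`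
and `Π` hold on every matroid of rank `≤ q`, no other hypothesis.  (b) The targets above a demanding set `B` (rank
`q − 1`, spanning complement): for `y ∉ cl B` the set `B ∪ y` is a top-threshold target
(`insert_mem_levelSetCoQ_top_of_spanning`), its coloops are those of `B` and `y` (`coloops_insert_of_notMem_clF`,
`card_coloops_insert_of_notMem_clF`), so its demanding-coloop count is at most `κ(B) + 1`
(`card_filter_coloops_insert_le`) and its slack `q − d(B ∪ y)` is at least `q − 1 − κ(B)` — the self-payment of
the dependent demanding sets in the paper's §43(c) (Part A).  Nothing open is asserted.
-/

open scoped Matroid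

namespace PercRepro.Cogirth

open Finset ThmH Skew Shadow Profile

variable {α : Type} [DecidableEq α] {N : Matroid α} [N.Finite] {q : ℕ}

section RankQ

/-- **The threshold `q − 1` is trivial at rank `≤ q`** (`1 ≤ q`): `(I_{q−1}) ⟺ (I_q)` and `(I_q)` is vacuous. -/
theorem thresholdIneq_pred_of_rk_le (hq : 1 ≤ q) (hR : rk N (gr N) ≤ q) : ThresholdIneq N q (q - 1) :=
  (thresholdIneq_pred_iff hq).2 (thresholdIneq_of_rk_le hR)

/-- **The row `(q − 1, q)` of `Π⁻` on every matroid of rank `≤ q`** (`1 ≤ q`), no other hypothesis. -/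
theorem profileIneqMinusQ_pred_of_rk_le (hq : 1 ≤ q) (hR : rk N (gr N) ≤ q) : ProfileIneqMinusQ N (q - 1) q :=
  (thresholdIneq_iff_row hq).1 (thresholdIneq_pred_of_rk_le hq hR)

/-- **The row `(Π_{q−1,q})` on every matroid of rank `≤ q`** (`1 ≤ q`). -/
theorem profileIneq_pred_of_rk_le (hq : 1 ≤ q) (hR : rk N (gr N) ≤ q) : ProfileIneq N (q - 1) q :=
  profileIneq_of_minusQ (by omega) (profileIneqMinusQ_pred_of_rk_le hq hR)

end RankQ

section Above

/-- **The coloops of `B ∪ y` for `y ∉ cl B`** are `y` and the coloops of `B`: a coloop `x` of `B` stays one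
(`x ∈ cl((B ∖ x) ∪ y)` would force `ρ(B ∪ y) ≤ ρ(B)`), and a non-coloop of `B` stays a non-coloop. -/
theorem coloops_insert_of_notMem_clF {B : Finset α} (hB : B ⊆ gr N) {y : α} (hy : y ∈ gr N)
    (hycl : y ∉ clF N B) : coloops N (insert y B) = insert y (coloops N B) := by
  have hyB : y ∉ B := fun h => hycl (subset_clF hB h)
  have hrkB : rk N (insert y B) = rk N B + 1 := by
    rw [rk_insert_eq hy hB, if_neg hycl]
  ext x
  simp only [mem_coloops, mem_insert]
  constructor
  · rintro ⟨hx | hx, hxcl⟩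
    · exact Or.inl hx
    · right
      refine ⟨hx, fun hc => hxcl ?_⟩
      have hxy : x ≠ y := fun h => hyB (h ▸ hx)
      rw [erase_insert_of_ne hxy.symm]
      exact clF_mono (subset_insert y (B.erase x)) hc
  · rintro (rfl | ⟨hx, hxcl⟩)
    · refine ⟨Or.inl rfl, ?_⟩
      rw [erase_insert hyB]
      exact hycl
    · have hxy : x ≠ y := fun h => hyB (h ▸ hx)
      refine ⟨Or.inr hx, ?_⟩
      rw [erase_insert_of_ne hxy.symm]
      intro hc
      rw [mem_clF_iff_rk_insert (hB hx) (insert_subset hy ((erase_subset x B).trans hB))] at hc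
      rw [insert_comm, insert_erase hx] at hc
      have h1 := rk_insert_eq hy ((erase_subset x B).trans hB)
      have h2 := rk_insert_eq (hB hx) ((erase_subset x B).trans hB)
      rw [insert_erase hx, if_neg hxcl] at h2
      rw [hrkB, h2] at hc
      split_ifs at h1 with h3
      · omega
      · omega

/-- `#coloops(B ∪ y) = #coloops(B) + 1` for `y ∉ cl B`. -/
theorem card_coloops_insert_of_notMem_clF {B : Finset α} (hB : B ⊆ gr N) {y : α} (hy : y ∈ gr N)
    (hycl : y ∉ clF N B) : (coloops N (insert y B)).card = (coloops N B).card + 1 := by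
  rw [coloops_insert_of_notMem_clF hB hy hycl, card_insert_of_notMem]
  intro h
  exact hycl (subset_clF hB (mem_coloops.1 h).1)

/-- **`B ∪ y` is a top-threshold target** for a demanding `B` (rank `q − 1`, spanning complement) and
`y ∉ cl B`: its rank is `q` and its complement has rank `≥ ρ(E) − 1`. -/
theorem insert_mem_levelSetCoQ_top_of_spanning (hq : 1 ≤ q) {B : Finset α} (hB : B ∈ Rq N (q - 1))
    (hBsp : rk N (gr N \ B) = rk N (gr N)) {y : α} (hy : y ∈ gr N \ clF N B) :
    insert y B ∈ levelSetCoQ N (rk N (gr N) - 1) q := by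
  obtain ⟨hBg, hBr⟩ := mem_Rq.1 hB
  have hrk : rk N B = q - 1 := rk_eq_of_eRk_eq hBr
  have hyg : y ∈ gr N := (mem_sdiff.1 hy).1
  have hycl : y ∉ clF N B := (mem_sdiff.1 hy).2
  refine mem_levelSetCoQ.2 ⟨⟨insert_subset hyg hBg, ?_⟩, ?_⟩
  · rw [← coe_rk, rk_insert_eq hyg hBg, if_neg hycl, hrk]
    congr 1
    omega
  · have heq : gr N \ insert y B = (gr N \ B).erase y := by
      ext w
      simp only [mem_sdiff, mem_insert, mem_erase, not_or]
      tauto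
    have h := rk_le_rk_erase_succ (N := N) (sdiff_subset : gr N \ B ⊆ gr N) y
    rw [heq]
    omega

/-- **The demanding coloops of `B ∪ y` number at most `κ(B) + 1`**: so the slack `q − d(B ∪ y)` of the target
`B ∪ y` is at least `q − 1 − κ(B)` — the self-payment of the dependent demanding sets. -/
theorem card_filter_coloops_insert_le {B : Finset α} (hB : B ⊆ gr N) {y : α} (hy : y ∈ gr N)
    (hycl : y ∉ clF N B) (P : α → Prop) [DecidablePred P] :
    ((coloops N (insert y B)).filter P).card ≤ (coloops N B).card + 1 := by
  rw [← card_coloops_insert_of_notMem_clF hB hy hycl]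
  exact card_filter_le _ _

end Above

end PercRepro.Cogirth
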